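import Mathlib
import Summits.Ventures.PercRepro2.Defs
import Summits.Ventures.PercRepro2.Independence
import Summits.Ventures.PercRepro2.Harris
import Summits.Ventures.PercRepro2.Graph
import Summits.Ventures.PercRepro2.Exploration
import Summits.Ventures.PercRepro2.Events
import Summits.Ventures.PercRepro2.FourFunctions
import Summits.Ventures.PercRepro2.Induced
import Summits.Ventures.PercRepro2.Frontier
import Summits.Ventures.PercRepro2.ObsIndependence
import Summits.Ventures.PercRepro2.BHK
import Summits.Ventures.PercRepro2.BHKEvents
import Summits.Ventures.PercRepro2.OrderPreservation
import Summits.Ventures.PercRepro2.OrderPreservationDual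
import Summits.Ventures.PercRepro2.VdBKahn
import Summits.Ventures.PercRepro2.BHKAvoid
import Summits.Ventures.PercRepro2.R2PrimeThreeReduction
import Summits.Ventures.PercRepro2.YBridge
import Summits.Ventures.PercRepro2.Yu1Functionals
import Summits.Ventures.PercRepro2.Yu1Events
import Summits.Ventures.PercRepro2.Yu1
import Summits.Ventures.PercRepro2.LBSplit
import Summits.Ventures.PercRepro2.YDelta
import Summits.Ventures.PercRepro2.SD
import Summits.Ventures.PercRepro2.Lambda

/-!
# Layer cake: the up-set form of (SD) is equivalent to the increasing-functional form
(blind cell PercRepro2, typer-1)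

`nonneg_of_upperSet_indicators`: on a finite poset, a functional that is additive, homogeneous and
non-negative on the indicators of up-sets is non-negative on every monotone non-negative `F`
(strong induction on the number of positive values of `F`, peeling off `t · 1_{F ≥ t}` with `t` the
least positive value).  Applied to the slack functional `Φ F = E[F u; R] W − E[F ψ; R] P(PD)`:
`SDLightFunUp_of_SDLightUp`, hence `SDLightUp_iff_funUp` — p1's increasing-functional statement
(INBOX 21:20Z) and the up-set statement of record (21:25Z) are the same theorem target.
-/

namespace Summit.Ventures.PercRepro2

open UnionCluster Yu1

namespace Lambda

section LayerCake

variable {α : Type*} [Fintype α] [PartialOrder α] {R : Type*} [Field R] [LinearOrder R]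
  [IsStrictOrderedRing R]

/-- **Layer cake on a finite poset**: a functional `Φ` that is additive, homogeneous and
non-negative on the indicators of up-sets is non-negative on every monotone non-negative `F`
(strong induction on the number of positive values of `F`: peel off `t · 1_{F ≥ t}` with `t` the
least positive value). -/
theorem nonneg_of_upperSet_indicators (Φ : (α → R) → R)
    (hadd : ∀ F G : α → R, Φ (fun x => F x + G x) = Φ F + Φ G)
    (hsmul : ∀ (c : R) (F : α → R), Φ (fun x => c * F x) = c * Φ F)
    (hup : ∀ U : Set α, IsUpperSet U → 0 ≤ Φ (U.indicator 1)) :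
    ∀ (n : ℕ) (F : α → R), Monotone F → (∀ x, 0 ≤ F x) →
      ((Finset.univ.image F).filter (fun t => 0 < t)).card = n → 0 ≤ Φ F := by
  intro n
  induction n using Nat.strong_induction_on with
  | _ n ih =>
  intro F hF hF0 hn
  classical
  by_cases hPe : (Finset.univ.image F).filter (fun t => 0 < t) = ∅
  · -- `F ≡ 0`
    have hF' : ∀ x, F x = 0 := by
      intro x
      by_contra hx
      have hpos : 0 < F x := lt_of_le_of_ne (hF0 x) (Ne.symm hx)
      have hmem : F x ∈ (Finset.univ.image F).filter (fun t => 0 < t) :=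
        Finset.mem_filter.2 ⟨Finset.mem_image_of_mem F (Finset.mem_univ x), hpos⟩
      rw [hPe] at hmem
      exact Finset.notMem_empty _ hmem
    have hF0' : F = fun x => (0 : R) * F x := by
      funext x
      rw [hF' x, mul_zero]
    rw [hF0', hsmul, zero_mul]
  · have hne : ((Finset.univ.image F).filter (fun t => 0 < t)).Nonempty :=
      Finset.nonempty_iff_ne_empty.2 hPe
    obtain ⟨t, htP, hmin⟩ : ∃ t ∈ (Finset.univ.image F).filter (fun t => 0 < t),
        ∀ s ∈ (Finset.univ.image F).filter (fun t => 0 < t), t ≤ s :=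
      ⟨_, Finset.min'_mem _ hne, fun s hs => Finset.min'_le _ s hs⟩
    have htpos : 0 < t := (Finset.mem_filter.1 htP).2
    -- `U = {x | t ≤ F x}` is an up-set; below `t` the function vanishes
    have hUup : IsUpperSet {x | t ≤ F x} := fun x y hxy hx => le_trans hx (hF hxy)
    have hzero : ∀ x, x ∉ {x | t ≤ F x} → F x = 0 := by
      intro x hx
      by_contra h0
      have hpos : 0 < F x := lt_of_le_of_ne (hF0 x) (Ne.symm h0)
      have hmem : F x ∈ (Finset.univ.image F).filter (fun t => 0 < t) :=
        Finset.mem_filter.2 ⟨Finset.mem_image_of_mem F (Finset.mem_univ x), hpos⟩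
      exact hx (hmin _ hmem)
    -- `G = F − t · 1_U`
    have hG0 : ∀ x, 0 ≤ F x - t * ({x | t ≤ F x} : Set α).indicator 1 x := by
      intro x
      by_cases hx : x ∈ ({x | t ≤ F x} : Set α)
      · rw [Set.indicator_of_mem hx, Pi.one_apply, mul_one]
        exact sub_nonneg.2 hx
      · rw [Set.indicator_of_notMem hx, mul_zero, sub_zero]
        exact hF0 x
    have hGmono : Monotone (fun x => F x - t * ({x | t ≤ F x} : Set α).indicator 1 x) := by
      intro x y hxy
      by_cases hx : x ∈ ({x | t ≤ F x} : Set α)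
      · have hy : y ∈ ({x | t ≤ F x} : Set α) := hUup hxy hx
        simp only [Set.indicator_of_mem hx, Set.indicator_of_mem hy, Pi.one_apply, mul_one]
        exact sub_le_sub_right (hF hxy) t
      · simp only [Set.indicator_of_notMem hx, mul_zero, sub_zero, hzero x hx]
        exact hG0 y
    have hFG : F = fun x => (F x - t * ({x | t ≤ F x} : Set α).indicator 1 x) +
        t * ({x | t ≤ F x} : Set α).indicator 1 x := by
      funext x
      ring
    -- the positive values of `G` are among `{s − t | s ∈ P, s ≠ t}`
    have hsub : (Finset.univ.image (fun x => F x - t * ({x | t ≤ F x} : Set α).indicator 1 x)).filter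
        (fun s => 0 < s) ⊆
        (((Finset.univ.image F).filter (fun t => 0 < t)).erase t).image (fun s => s - t) := by
      intro s hs
      rw [Finset.mem_filter, Finset.mem_image] at hs
      obtain ⟨⟨x, _, hxs⟩, hspos⟩ := hs
      rw [Finset.mem_image]
      refine ⟨s + t, ?_, by ring⟩
      rw [Finset.mem_erase]
      have hx : x ∈ ({x | t ≤ F x} : Set α) := by
        by_contra hx
        rw [Set.indicator_of_notMem hx, mul_zero, sub_zero, hzero x hx] at hxs
        rw [← hxs] at hspos
        exact lt_irrefl _ hspos
      rw [Set.indicator_of_mem hx, Pi.one_apply, mul_one] at hxs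
      have hFx : F x = s + t := by linarith
      refine ⟨fun h => ?_, ?_⟩
      · have : s = 0 := by linarith
        rw [this] at hspos
        exact lt_irrefl _ hspos
      · rw [Finset.mem_filter]
        refine ⟨?_, by linarith⟩
        rw [← hFx]
        exact Finset.mem_image_of_mem F (Finset.mem_univ x)
    have hcard : ((Finset.univ.image (fun x => F x - t * ({x | t ≤ F x} : Set α).indicator 1 x)).filter
        (fun s => 0 < s)).card < n := by
      calc ((Finset.univ.image (fun x => F x - t * ({x | t ≤ F x} : Set α).indicator 1 x)).filter
            (fun s => 0 < s)).card
          ≤ ((((Finset.univ.image F).filter (fun t => 0 < t)).erase t).image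
              (fun s => s - t)).card := Finset.card_le_card hsub
        _ ≤ (((Finset.univ.image F).filter (fun t => 0 < t)).erase t).card := Finset.card_image_le
        _ < ((Finset.univ.image F).filter (fun t => 0 < t)).card := Finset.card_erase_lt_of_mem htP
        _ = n := hn
    have hΦG := ih _ hcard _ hGmono hG0 rfl
    have hΦU := hup _ hUup
    rw [hFG, hadd, hsmul]
    nlinarith

end LayerCake

section FunUp

variable {V : Type*} {E : Type*} [Fintype E] [DecidableEq E] [Fintype V] [DecidableEq V]
  {R : Type*} [Field R] [LinearOrder R] [IsStrictOrderedRing R]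

/-- **The up-set form gives the increasing-functional form** (layer cake):
`SDLightUp → SDLightFunUp`. -/
theorem SDLightFunUp_of_SDLightUp (p : E → R) (ends : E → Sym2 V) (a₁ a₂ a₃ b : V)
    (h : SDLightUp p ends a₁ a₂ a₃ b) : SDLightFunUp p ends a₁ a₂ a₃ b := by
  intro F hF hF0
  -- the slack functional `Φ F = E[F u; R] · W − E[F ψ; R] · P(PD)`
  let Φ : (Set V → R) → R := fun F =>
    expect p (fun ω => F (cluster ends ω a₁) * u p ends a₂ a₃ (cluster ends ω a₁) *
        (avoidAll ends a₁ {a₂, a₃}).indicator 1 ω) *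
      (massM2 p ends a₁ a₂ a₃ b + deltaT p ends a₁ a₂ a₃ b) -
    expect p (fun ω => F (cluster ends ω a₁) * psi p ends a₂ a₃ b (cluster ends ω a₁) *
        (avoidAll ends a₁ {a₂, a₃}).indicator 1 ω) * prob p (PDEvent ends a₁ a₂ a₃)
  have hadd : ∀ F G : Set V → R, Φ (fun x => F x + G x) = Φ F + Φ G := by
    intro F G
    simp only [Φ]
    have e1 : expect p (fun ω => (F (cluster ends ω a₁) + G (cluster ends ω a₁)) *
        u p ends a₂ a₃ (cluster ends ω a₁) * (avoidAll ends a₁ {a₂, a₃}).indicator 1 ω) =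
        (1 : R) * expect p (fun ω => F (cluster ends ω a₁) * u p ends a₂ a₃ (cluster ends ω a₁) *
            (avoidAll ends a₁ {a₂, a₃}).indicator 1 ω) +
          (1 : R) * expect p (fun ω => G (cluster ends ω a₁) * u p ends a₂ a₃ (cluster ends ω a₁) *
            (avoidAll ends a₁ {a₂, a₃}).indicator 1 ω) := by
      apply expect_comb
      intro ω
      ring
    have e2 : expect p (fun ω => (F (cluster ends ω a₁) + G (cluster ends ω a₁)) *
        psi p ends a₂ a₃ b (cluster ends ω a₁) * (avoidAll ends a₁ {a₂, a₃}).indicator 1 ω) =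
        (1 : R) * expect p (fun ω => F (cluster ends ω a₁) * psi p ends a₂ a₃ b (cluster ends ω a₁) *
            (avoidAll ends a₁ {a₂, a₃}).indicator 1 ω) +
          (1 : R) * expect p (fun ω => G (cluster ends ω a₁) * psi p ends a₂ a₃ b (cluster ends ω a₁) *
            (avoidAll ends a₁ {a₂, a₃}).indicator 1 ω) := by
      apply expect_comb
      intro ω
      ring
    rw [e1, e2]
    ring
  have hsmul : ∀ (c : R) (F : Set V → R), Φ (fun x => c * F x) = c * Φ F := by
    intro c F
    simp only [Φ]
    have e1 : expect p (fun ω => c * F (cluster ends ω a₁) *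
        u p ends a₂ a₃ (cluster ends ω a₁) * (avoidAll ends a₁ {a₂, a₃}).indicator 1 ω) =
        c * expect p (fun ω => F (cluster ends ω a₁) * u p ends a₂ a₃ (cluster ends ω a₁) *
            (avoidAll ends a₁ {a₂, a₃}).indicator 1 ω) +
          (0 : R) * expect p (fun ω => F (cluster ends ω a₁) * u p ends a₂ a₃ (cluster ends ω a₁) *
            (avoidAll ends a₁ {a₂, a₃}).indicator 1 ω) := by
      apply expect_comb
      intro ω
      ring
    have e2 : expect p (fun ω => c * F (cluster ends ω a₁) *
        psi p ends a₂ a₃ b (cluster ends ω a₁) * (avoidAll ends a₁ {a₂, a₃}).indicator 1 ω) =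
        c * expect p (fun ω => F (cluster ends ω a₁) * psi p ends a₂ a₃ b (cluster ends ω a₁) *
            (avoidAll ends a₁ {a₂, a₃}).indicator 1 ω) +
          (0 : R) * expect p (fun ω => F (cluster ends ω a₁) * psi p ends a₂ a₃ b (cluster ends ω a₁) *
            (avoidAll ends a₁ {a₂, a₃}).indicator 1 ω) := by
      apply expect_comb
      intro ω
      ring
    rw [e1, e2]
    ring
  have hup : ∀ U : Set (Set V), IsUpperSet U → 0 ≤ Φ (U.indicator 1) := by
    intro U hU
    have := (SDLight_iff_fun p ends a₁ a₂ a₃ b U).1 (h U hU)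
    unfold SDLightFun at this
    simp only [Φ]
    linarith
  have key := nonneg_of_upperSet_indicators Φ hadd hsmul hup _ F hF hF0 rfl
  unfold SDLightFun
  simp only [Φ] at key
  linarith

/-- **The two statements of record are equivalent**: `SDLightUp ↔ SDLightFunUp`. -/
theorem SDLightUp_iff_funUp (p : E → R) (ends : E → Sym2 V) (a₁ a₂ a₃ b : V) :
    SDLightUp p ends a₁ a₂ a₃ b ↔ SDLightFunUp p ends a₁ a₂ a₃ b :=
  ⟨SDLightFunUp_of_SDLightUp p ends a₁ a₂ a₃ b, SDLightUp_of_funUp p ends a₁ a₂ a₃ b⟩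

end FunUp

end Lambda

end Summit.Ventures.PercRepro2
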